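import Summits.AtomisticToContinuum.BoseEinsteinCondensation.Theses.BECStoquasticCensoring
import Literature.Probability.LatticeModels.VillainCurrentModel
import HarnessLib

/-!
# Birth skeleton — crux `VillainCurrentLRO` (item stmt-AtomisticToContinuum-11474)

Route `AtomisticToContinuum/BoseEinsteinCondensation/BECStoquasticCensoring`, crux (rank 2)
`Summit.AtomisticToContinuum.BoseEinsteinCondensation.Theses.BECStoquasticCensoring.VillainCurrentLRO`:
uniform equal-time block long-range order `c (M+1)⁶ Z(0) ≤ ∑_{x,y} Z(δ_{(x,0)} − δ_{(y,0)})` of the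
(3+1)-dimensional Villain integer-current model on `(ℤ/(M+1))³ × ℤ/(T+1)` for EVERY bond stiffness
field `κ` pinched between direction-wise base stiffnesses `K_i ≥ K₀` and `Λ K_i`.

THE LINE (the route's own "why it might fail" text made formal): the inline `ℝ≥0∞` current sums of
the item are the current sums of the tree's `VillainCurrentModel.ofCurried κ`
(`Literature/Probability/LatticeModels/VillainCurrentModel.lean`, `currentSum_ofCurried`), so the
crux is the composition of two genuine lattice-model theorems and a dictionary:

* `stub_ginibreMonotone` — GINIBRE MONOTONICITY ON THE CURRENT SIDE (Aizenman–Harel–Peled–Shapiro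
  2021, Cor. 11.4, through the worm/duality representation `Z(ρ_{xy})/Z(0) = ⟨cos(θ_x − θ_y)⟩_κ`):
  raising any bond stiffness raises every equal-time worm two-point function
  `G_P((x,0),(y,0)) = Z_P(wormSource x y)/Z_P(0)`.  [AizenmanEtAl2021 Cor 11.4; FrohlichSpencerCMP1982 §2]
* `stub_isotropicFloorLRO` — LONG-RANGE ORDER OF THE ISOTROPIC FLOOR MODEL: there are `K₀, c > 0`
  such that the space-time ISOTROPIC homogeneous Villain current model with constant stiffness
  `K ≥ K₀` on every bond of `(ℤ/(M+1))³ × ℤ/(T+1)` has `c (M+1)⁶ ≤ ∑_{x,y} G((x,0),(y,0))`,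
  uniformly in `M`, `T` (incl. odd sides and `T + 1 = 1`) — 3-D Villain LRO à la Fröhlich–Spencer /
  Garban–Spencer run inside the time-zero slice.  [FrohlichSpencerCMP1982; GarbanSpencer2022 Thm 1.3, Rem. 1, 10; KennedyKing1986]
* `VillainCurrentLRO_of (h₁ : Goal.stub_ginibreMonotone) (h₂ : Goal.stub_isotropicFloorLRO) : VillainCurrentLRO`
  — the kernel-checked composition (real proof, no sorry; `Goal.stub_*` are the verbatim stub statements as
  named `Prop`s, so the hypotheses are the stubs BY NAME; `VillainCurrentLRO_skeleton` applies it to the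
  sorried stubs): dictionary
  inline-`tsum` ↔ `ofCurried κ` / `wormSource`, comparison of `κ ≥ K_i ≥ K₀` down to the constant
  floor `K₀` by the first stub, the floor's LRO by the second, and the `ℝ≥0∞` algebra
  `Z(ρ_{xy}) = G · Z(0)`.  The upper pinch `κ ≤ Λ K_i` is not needed (monotone comparison only uses
  the floor), so `K₀, c` are uniform in `Λ` as well.

How the stubs discharge (for the lead prover; NOT done here — registrar files the skeleton only):
`stub_ginibreMonotone` is the equal-time case of the tree's
`Literature.Probability.LatticeModels.VillainCurrentModel.twoPoint_mono`
(`Literature/Probability/LatticeModels/VillainCurrentDuality.lean`, via `pinnedVillainTwoPoint_mono`);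
`stub_isotropicFloorLRO` is the constant-field case of the engine
`Summit.AtomisticToContinuum.BoseEinsteinCondensation.Theorems.villainCurrent_blockSum_lowerBound`
(`Theorems/BECStoquasticCensoringHomogeneousVillainLRO.lean`, landed with the proved support item
`HomogeneousVillainLRO` stmt-11478) after dividing by `Z(0)` (`VillainCurrentModel.sum_twoPoint_equalTime`),
or directly `Literature.Probability.LatticeModels.villain_longRangeOrder 3` + `sliceEmbedding` as there.

BC3 probes (folder `bc/probe_*.lean`, stub signature restated inline, this file NOT imported): for each
stub, `stub → VillainCurrentLRO` and `stub → BoseEinsteinCondensation` by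
`first | exact? | simpa | simpa [C] | (unfold C; simpa) | aesop` (maxHeartbeats 400000) all FAIL (rc 1,
unsolved goal `⊢ VillainCurrentLRO` / `⊢ BoseEinsteinCondensation`).

Disproof used: none on file (`ledger crux ls stmt-AtomisticToContinuum-11474`: no `Disproof.lean`,
no landed `Negative/` lemma, 2026-08-17).
-/

noncomputable section

namespace Summit.AtomisticToContinuum.BoseEinsteinCondensation.Cruxes.VillainCurrentLRO.Birth

open Literature.Probability.LatticeModels Literature.Probability.LatticeModels.JCurrent
open scoped ENNReal BigOperators

/-! ## Audit names of the stub statements (the hypotheses of `VillainCurrentLRO_of` BY NAME) -/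

namespace Goal

/-- Statement of stub 1 `stub_ginibreMonotone` (verbatim copy of its signature). -/
abbrev stub_ginibreMonotone : Prop :=
  ∀ (M T : ℕ) (P Q : VillainCurrentModel 3 (M + 1) (T + 1)),
      (∀ b, P.stiffness b ≤ Q.stiffness b) →
      ∀ x y : TorusSite 3 (M + 1),
        P.twoPoint ((x, 0) : SpaceTimeSite 3 (M + 1) (T + 1)) (y, 0) ≤
          Q.twoPoint ((x, 0) : SpaceTimeSite 3 (M + 1) (T + 1)) (y, 0)

/-- Statement of stub 2 `stub_isotropicFloorLRO` (verbatim copy of its signature). -/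
abbrev stub_isotropicFloorLRO : Prop :=
  ∃ K₀ c : ℝ, 0 < K₀ ∧ 0 < c ∧ ∀ (M T : ℕ) (K : ℝ), K₀ ≤ K →
      ∀ P₀ : VillainCurrentModel 3 (M + 1) (T + 1), (∀ b, P₀.stiffness b = K) →
        ENNReal.ofReal c * ((M + 1 : ℝ≥0∞) ^ 6) ≤
          ∑ x : TorusSite 3 (M + 1), ∑ y : TorusSite 3 (M + 1),
            P₀.twoPoint ((x, 0) : SpaceTimeSite 3 (M + 1) (T + 1)) (y, 0)

end Goal

/-! ## Registered stubs (the only `sorry`s of this file) -/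

/-- **STUB 1 — Ginibre monotonicity of the equal-time worm two-point function in the stiffness
field** (current side of Aizenman–Harel–Peled–Shapiro 2021, Cor. 11.4, on the bond multigraph of the
space-time torus `(ℤ/(M+1))³ × ℤ/(T+1)`): if `P.stiffness b ≤ Q.stiffness b` on every bond then
`G_P((x,0),(y,0)) ≤ G_Q((x,0),(y,0))` for all spatial sites `x, y`.
[cite: AizenmanEtAl2021, Cor. 11.4] -/
theorem stub_ginibreMonotone :
    ∀ (M T : ℕ) (P Q : VillainCurrentModel 3 (M + 1) (T + 1)),
      (∀ b, P.stiffness b ≤ Q.stiffness b) →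
      ∀ x y : TorusSite 3 (M + 1),
        P.twoPoint ((x, 0) : SpaceTimeSite 3 (M + 1) (T + 1)) (y, 0) ≤
          Q.twoPoint ((x, 0) : SpaceTimeSite 3 (M + 1) (T + 1)) (y, 0) := by
  sorry

/-- **STUB 2 — equal-time block long-range order of the isotropic floor model, uniformly in the
space-time shape**: there are `K₀ > 0` and `c > 0` such that for all `M, T`, every `K ≥ K₀` and every
Villain current model `P₀` on `(ℤ/(M+1))³ × ℤ/(T+1)` whose stiffness is the constant `K` on every
(spatial and temporal) bond, `c (M+1)⁶ ≤ ∑_{x,y} G_{P₀}((x,0),(y,0))` (in `ℝ≥0∞`).  Fröhlich–Spencer /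
Garban–Spencer 3-D Villain long-range order run inside the time-zero slice of the torus; no
reflection positivity, hence no parity condition on `M + 1` and no dependence on `T`.
[cite: GarbanSpencer2022, Thm 1.3, Remarks 1 and 10; FrohlichSpencerCMP1982, §2] -/
theorem stub_isotropicFloorLRO :
    ∃ K₀ c : ℝ, 0 < K₀ ∧ 0 < c ∧ ∀ (M T : ℕ) (K : ℝ), K₀ ≤ K →
      ∀ P₀ : VillainCurrentModel 3 (M + 1) (T + 1), (∀ b, P₀.stiffness b = K) →
        ENNReal.ofReal c * ((M + 1 : ℝ≥0∞) ^ 6) ≤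
          ∑ x : TorusSite 3 (M + 1), ∑ y : TorusSite 3 (M + 1),
            P₀.twoPoint ((x, 0) : SpaceTimeSite 3 (M + 1) (T + 1)) (y, 0) := by
  sorry

/-- **ASSEMBLY — `VillainCurrentLRO_of : stub_ginibreMonotone → stub_isotropicFloorLRO → VillainCurrentLRO`**
(hypotheses = the two stub statements BY NAME, `Goal.stub_*`; kernel-checked, no `sorry`).  Given `Λ ≥ 1`, take the floor constants `K₀, c` of STUB 2 (uniform in `Λ`).  For
`K_i ≥ K₀` and `K_i ≤ κ ≤ Λ K_i` the field `κ` is positive, the item's inline current sums are those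
of `P = ofCurried κ` (`currentSum_ofCurried`), its inline sources are `wormSource x y`
(`inlineSource_eq_wormSource`), and `Z(ρ_{xy}) = G_P((x,0),(y,0)) · Z(0)` (`twoPoint_equalTime`);
STUB 1 compares `G_P ≥ G_{P₀}` termwise with the constant floor model `P₀ = homogeneous K₀ ≤ κ`, and
STUB 2 bounds `∑ G_{P₀} ≥ c (M+1)⁶`. [folklore] -/
theorem VillainCurrentLRO_of (hmono : Goal.stub_ginibreMonotone) (hfloor : Goal.stub_isotropicFloorLRO) :
    _root_.Summit.AtomisticToContinuum.BoseEinsteinCondensation.Theses.BECStoquasticCensoring.VillainCurrentLRO := by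
  obtain ⟨K₀, c, hK₀, hc, H⟩ := hfloor
  intro Λ _hΛ
  refine ⟨K₀, c, hc, ?_⟩
  intro M T Kd hKd κ hκ Z
  -- positivity of the base stiffnesses and of the stiffness field
  have hKpos : ∀ i, 0 < Kd i := fun i => lt_of_lt_of_le hK₀ (hKd i)
  have hκpos : ∀ s i, 0 < κ s i := fun s i => lt_of_lt_of_le (hKpos i) (hκ s i).1
  -- the item's inline current sums are the current sums of the Villain current model `ofCurried κ`
  have hZ : ∀ q : SpaceTimeSite 3 (M + 1) (T + 1) → ℤ,
      Z q = (VillainCurrentModel.ofCurried (d := 3) (L := M + 1) (M := T + 1) κ hκpos).currentSum q :=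
    fun q => (VillainCurrentModel.currentSum_ofCurried (d := 3) (L := M + 1) (M := T + 1) κ hκpos q).symm
  have hsrc : ∀ x y : TorusSite 3 (M + 1),
      (fun z : SpaceTimeSite 3 (M + 1) (T + 1) =>
        (if z = (x, 0) then (1 : ℤ) else 0) - (if z = (y, 0) then 1 else 0)) = wormSource x y :=
    fun x y => VillainCurrentModel.inlineSource_eq_wormSource x y
  -- the model and the constant floor model `K₀ ≤ K_i ≤ κ`
  set P : VillainCurrentModel 3 (M + 1) (T + 1) :=
    VillainCurrentModel.ofCurried (d := 3) (L := M + 1) (M := T + 1) κ hκpos with hP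
  obtain ⟨P₀, hP₀⟩ : ∃ P₀ : VillainCurrentModel 3 (M + 1) (T + 1), ∀ b, P₀.stiffness b = K₀ :=
    ⟨VillainCurrentModel.homogeneous (fun _ => K₀) (fun _ => hK₀), fun _ => rfl⟩
  have hle : ∀ b, P₀.stiffness b ≤ P.stiffness b := by
    intro b
    rw [hP₀ b, hP, VillainCurrentModel.ofCurried_stiffness]
    exact (hKd _).trans (hκ _ _).1
  -- STUB 2 at the floor, STUB 1 termwise
  have hkey : ENNReal.ofReal c * ((M + 1 : ℝ≥0∞) ^ 6) ≤
      ∑ x : TorusSite 3 (M + 1), ∑ y : TorusSite 3 (M + 1),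
        P.twoPoint ((x, 0) : SpaceTimeSite 3 (M + 1) (T + 1)) (y, 0) :=
    (H M T K₀ le_rfl P₀ hP₀).trans
      (Finset.sum_le_sum fun x _ => Finset.sum_le_sum fun y _ => hmono M T P₀ P hle x y)
  -- back to the current sums: `Z(ρ_{xy}) = G_P((x,0),(y,0)) · Z(0)`
  calc ENNReal.ofReal c * ((M + 1 : ℝ≥0∞) ^ 6) * Z 0
      = ENNReal.ofReal c * ((M + 1 : ℝ≥0∞) ^ 6) * P.partitionFunction := by
        rw [hZ 0]; rfl
    _ ≤ (∑ x : TorusSite 3 (M + 1), ∑ y : TorusSite 3 (M + 1),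
          P.twoPoint ((x, 0) : SpaceTimeSite 3 (M + 1) (T + 1)) (y, 0)) * P.partitionFunction :=
        mul_le_mul' hkey le_rfl
    _ = ∑ x : TorusSite 3 (M + 1), ∑ y : TorusSite 3 (M + 1),
          P.twoPoint ((x, 0) : SpaceTimeSite 3 (M + 1) (T + 1)) (y, 0) * P.partitionFunction := by
        rw [Finset.sum_mul]
        exact Finset.sum_congr rfl fun x _ => Finset.sum_mul _ _ _
    _ = ∑ x : Fin 3 → ZMod (M + 1), ∑ y : Fin 3 → ZMod (M + 1),
          Z (fun z => (if z = (x, 0) then 1 else 0) - (if z = (y, 0) then 1 else 0)) := by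
        refine Finset.sum_congr rfl fun x _ => Finset.sum_congr rfl fun y _ => ?_
        rw [hsrc x y, hZ, VillainCurrentModel.twoPoint_equalTime,
          ENNReal.div_mul_cancel P.partitionFunction_ne_zero P.partitionFunction_ne_top]

/-- **The skeleton applied to the (sorried) stubs**: the crux `VillainCurrentLRO` BY NAME modulo exactly
`stub_ginibreMonotone` and `stub_isotropicFloorLRO` (no `sorry` of its own; its only `sorryAx` ancestry is
the two declared stubs). [folklore] -/
theorem VillainCurrentLRO_skeleton :
    _root_.Summit.AtomisticToContinuum.BoseEinsteinCondensation.Theses.BECStoquasticCensoring.VillainCurrentLRO :=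
  VillainCurrentLRO_of stub_ginibreMonotone stub_isotropicFloorLRO

end Summit.AtomisticToContinuum.BoseEinsteinCondensation.Cruxes.VillainCurrentLRO.Birth
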